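import Summits.HodgeConjecture.HodgeConjecture.Theorems.K2E1BLInvariantSigmaDescentU            -- ★ p859183 (this seat) FILE M: Borel descent (`measurable_invariantSigma_zFun_of_measurable`, `measurable_zFun_of_measurable`); brings FILE A ★ p858855
import Summits.HodgeConjecture.HodgeConjecture.Theorems.K2E1BorelConstantTermJensenU             -- ★ (this seat) FILE J: fibre Jensen `∫⁻ β·w·‖F_B‖² ≤ ∫⁻ β·w·‖F‖²`; brings ★ AVG (K2E4-p11 g3)
import Summits.HodgeConjecture.HodgeConjecture.Theorems.K2E1BLQuotientMeasureU                    -- ★ p858914 (K2E1-p08 g6): the unfolding `μZ = π_*(β ν_G)` transports (`(l)integral_weightedTruncMeasure_eq_of_unfolding`)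
import Summits.HodgeConjecture.HodgeConjecture.Theorems.K2E1BLConstantTermProjectionRestrictU2   -- ★ p858972 (this seat): `coe_comp_toBorelQuotient_mul` (the lift `⇑f ∘ π` is left-`B(F)`-invariant)
import Summits.HodgeConjecture.HodgeConjecture.Theorems.K2E1TruncatedEisensteinBoundedCMThree    -- ★ p857707 §1 (N-generic): `measurable_borelConstantTerm`; brings ★ `borelHeight_arithmeticBorel_mul`
import HarnessLib

/-!
# K1-L²'s cuspidality letter `hcnst`, P2b-SIDE, GENERAL CLASS: for `f ∈ 𝓗_k^cusp(Z_c)` the Borel constant term of the truncated lift `𝟙_{c<H}·⇑f ∘ π`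
# VANISHES `ν_G`-a.e. above the height `c` — `∀ᵐ g ∂ν_G, c < H(g) → (𝟙_{c<HZ}⇑f ∘ π)_B(g) = 0`

Campaign «EIS-R7-BL-SPH-2∕3», deal (17)∕(21) of dealer K2E1-plan (g6) (2026-09-04T09:53Z; half (ii) of the split of (13) with K2E1-p11 (g0), whose chart bridge
`K2E1TruncatedCuspConstantTermBridgeU2.hcnst_of_ae_borelConstantTerm_eq_zero` consumes the HEAD of this file as its `hii`; bytes agreed on the K2 bus 10:04–10:14Z).  THEOREMS ONLY
(no `def`, no `instance`, no notation, no named-fact hypothesis, no `sorry`); lane `--supports stmt-HodgeConjecture-24833 --as helper` (count-neutral).  Closes no socket.  EVERY rank `N`.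

THE MATHEMATICS [MoeglinWaldspurger1995, I.2.6, I.2.18; BernsteinLapid2019, §4 Claims 4–5].  `Z = B(F)∖G(𝔸)`, `μw = 𝟙_{c<HZ}·HZ^{−2k}·μZ`, `μZ = π_*(β ν_G)` (`β` a `B(F)♯`-covering
weight, letter `hμZ`), `𝓗_k(Z_c) = L²(μw)`, `cnst_k` = the orthogonal projection onto the `mN`-measurable classes, `𝓗^cusp = ker cnst_k`.  For a CLASS `f` put `Φ₀ := ⇑f ∘ π` and
`Ψ₀ := (Φ₀)_B` (fibre average).  (1) `zFun Ψ₀` is `mN`-measurable (★ FILE M) and in `L²(μw)` (★ FILE J fibre Jensen + ★ unfolding), so `[Ψ₀] ∈ range cnst_k`; (2) `⟪f, [Ψ₀]⟫ = 0`;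
(3) unfolding to `G(𝔸)` and averaging the factor `conj Φ₀` over the fibres (★ AVG-4; `𝟙_{c<H}H^{−2k}·Ψ₀` is `N(𝔸)`-invariant) gives `∫ β·𝟙_{c<H}H^{−2k}‖Ψ₀‖² dν_G = 0`, so `Ψ₀ = 0`
a.e. on `{β ≠ 0} ∩ {c < H}`; (4) the bad set `{c < H, Ψ₀ ≠ 0}` is `B(F)♯`-invariant and `Σ_γ β(γ g) = 1`, so countably many null translates cover it; on `{c < H}` the truncation is
invisible along the fibre, `(𝟙_{c<HZ}⇑f ∘ π)_B = Ψ₀`.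
* §1 lift and fibre average (measurability, invariances, s-finiteness of `ν_N`) · §2 the `L²` bound, orthogonality, STEP 3 `integral_wt_sq_fibreAverage_eq_zero` ·
  §3 HEADS **`ae_fibreAverage_eq_zero_of_mem_HNcusp`** and **`ae_borelConstantTerm_indicator_comp_eq_zero_of_mem_HNcusp`** (the agreed bytes).
HONEST LABEL: HC_CM is proved only modulo the 7 printed citations (2 remaining named inputs: hLiu418 = `stmt-HodgeConjecture-24832`, h413 = `stmt-HodgeConjecture-24833`) until rung 0
closes; this file asserts no named fact; its hypotheses are the structural unfolding letters of ★ AVG ∕ ★ A′ (`hconj`, `h𝓕`, `h𝓕₀`, `h𝓕top`, `hβ`, `hμZ`), all ★ at the CM pairs.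
References: [MoeglinWaldspurger1995] I.2.6, I.2.18, II.1.7 · [BernsteinLapid2019] §4 Claims 4–5 (p. 10) · [Folland1995] §2.6.
-/

set_option autoImplicit false
-- the mandated namespace repeats the single-problem summit's segment (`HodgeConjecture.HodgeConjecture`)
set_option linter.dupNamespace false

noncomputable section

open MeasureTheory MeasureTheory.Measure Set NumberField IsDedekindDomain Filter
open scoped ENNReal NNReal ComplexConjugate InnerProductSpace
open Literature.MeasureTheory.Group Literature.NumberTheory
open Literature.NumberTheory.Automorphic Literature.NumberTheory.Automorphic.UnitaryGroup AdelicGroupData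
open Summit.HodgeConjecture.HodgeConjecture.Cruxes.H413.K2E1BLBorelSpacesU2Defs
open Summit.HodgeConjecture.HodgeConjecture.Cruxes.H413.K2E1BLSpacesU2 (inner_cnstN_left_eq_right cnstN_eq_self_of_mem_lpMeas)
open Summit.HodgeConjecture.HodgeConjecture.Cruxes.H413.K2E1BLConstantTermProjectionU2 (borelConstantTerm_adelicUnipBorel_mul)
open Summit.HodgeConjecture.HodgeConjecture.Cruxes.H413.K2E1BLConstantTermProjectionRestrictU2 (coe_comp_toBorelQuotient_mul)
open Summit.HodgeConjecture.HodgeConjecture.Cruxes.H413.K2E1BLInvariantSigmaDescentU (measurable_invariantSigma_zFun_of_measurable measurable_zFun_of_measurable)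
open Summit.HodgeConjecture.HodgeConjecture.Cruxes.H413.K2E1BorelConstantTermJensenU (lintegral_mul_enorm_borelConstantTerm_sq_le_of)
open Summit.HodgeConjecture.HodgeConjecture.Cruxes.H413.K2E1BLQuotientMeasureU (lintegral_weightedTruncMeasure_eq_of_unfolding integral_weightedTruncMeasure_eq_of_unfolding)
open Summit.HodgeConjecture.HodgeConjecture.Cruxes.H413.K2E1BorelWeightAverage (integral_wt_smul_mul_conj_eq_mul_conj_borelConstantTerm_of)
open Summit.HodgeConjecture.HodgeConjecture.Cruxes.H413.K2E1TruncatedEisensteinBoundedCMThree (measurable_borelConstantTerm)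
open Summit.HodgeConjecture.HodgeConjecture.Cruxes.H413.K2E1IntertwiningAdjoint Summit.HodgeConjecture.HodgeConjecture.Cruxes.H413.K2E1IntertwinedSectionInvariance

namespace Summit.HodgeConjecture.HodgeConjecture.Cruxes.H413.K2E1TruncatedCuspConstantTermAEU2

variable {F E : Type} [Field F] [NumberField F] [Field E] [NumberField E] [Algebra F E] {c : E ≃ₐ[F] E} {N : ℕ} [NeZero N]
variable [MeasurableSpace (quasiSplit F E c N).Adelic] [BorelSpace (quasiSplit F E c N).Adelic]

/-! ## §1 The lift `Φ₀ = ⇑f ∘ π` of a class and its fibre average `Ψ₀ = (Φ₀)_B` -/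

section Lift

variable (k : ℕ) (c₁ : ℝ≥0) (μZ : Measure (borelQuotient F E c N)) (f : HN F E c N k c₁ μZ)

/-- The lift `Φ₀ = ⇑f ∘ π` is Borel on `G(𝔸)`. [cite: BernsteinLapid2019, §4 p. 10] -/
theorem measurable_coe_comp_toBorelQuotient :
    Measurable ((f : borelQuotient F E c N → ℂ) ∘ toBorelQuotient F E c N) :=
  (Lp.stronglyMeasurable f).measurable.comp (continuous_toBorelQuotient F E c N).measurable

omit [MeasurableSpace (quasiSplit F E c N).Adelic] [BorelSpace (quasiSplit F E c N).Adelic] in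
/-- The lift is left-`B(F)♯`-invariant (subgroup-of-`G(F)` form). [cite: BernsteinLapid2019, §4 p. 10] -/
theorem coe_comp_toBorelQuotient_arithmeticBorel_mul (b : (quasiSplit F E c N).arithmeticSubgroup) (hb : b ∈ arithmeticBorel F E c N)
    (x : (quasiSplit F E c N).Adelic) :
    ((f : borelQuotient F E c N → ℂ) ∘ toBorelQuotient F E c N) ((b : (quasiSplit F E c N).Adelic) * x) = ((f : borelQuotient F E c N → ℂ) ∘ toBorelQuotient F E c N) x :=
  coe_comp_toBorelQuotient_mul (f : borelQuotient F E c N → ℂ) _ ⟨(mem_arithmeticBorel_iff b).1 hb, b.2⟩ x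

omit [NeZero N] [BorelSpace (quasiSplit F E c N).Adelic] in
/-- A Haar measure on `N(𝔸)` (closed in the second countable locally compact `G(𝔸)`) is s-finite. [folklore] -/
theorem sFinite_of_isHaarMeasure_adelicUnipotent (νN : Measure ↥(adelicUnipotent F E c N)) [νN.IsHaarMeasure] : SFinite νN := by
  haveI := secondCountableTopology_adeleRing E
  haveI := locallyCompactSpace_adeleRing' E
  haveI : SecondCountableTopology (quasiSplit F E c N).Adelic := inferInstanceAs (SecondCountableTopology (adelic F E c N ((StdForm.antidiagonal N).over E)))
  haveI : LocallyCompactSpace (quasiSplit F E c N).Adelic := inferInstanceAs (LocallyCompactSpace (adelic F E c N ((StdForm.antidiagonal N).over E)))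
  haveI : SecondCountableTopology ↥(adelicUnipotent F E c N) := TopologicalSpace.Subtype.secondCountableTopology _
  haveI := t2Space_adeleRing_of_numberField E
  have hNcl : IsClosed ((adelicUnipotent F E c N : Set (quasiSplit F E c N).Adelic)) := by
    change IsClosed (⇑(adelicVal F E c N ((StdForm.antidiagonal N).over E)) ⁻¹'
      ((upperUnitriangular (Fin N) (AdeleRing (𝓞 E) E) : Subgroup (GL (Fin N) (AdeleRing (𝓞 E) E))) : Set (GL (Fin N) (AdeleRing (𝓞 E) E))))
    exact (isClosed_upperUnitriangular (R := AdeleRing (𝓞 E) E)).preimage continuous_subtype_val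
  haveI : LocallyCompactSpace ↥(adelicUnipotent F E c N) := hNcl.locallyCompactSpace
  infer_instance

variable (νN : Measure ↥(adelicUnipotent F E c N)) (𝓕 : Set ↥(adelicUnipotent F E c N))

/-- The fibre average `Ψ₀ = (⇑f ∘ π)_B` is Borel on `G(𝔸)` (★ `measurable_borelConstantTerm`). [cite: MoeglinWaldspurger1995, I.2.6] -/
theorem measurable_fibreAverage [SFinite νN] : Measurable (borelConstantTerm νN 𝓕 ((f : borelQuotient F E c N → ℂ) ∘ toBorelQuotient F E c N)) :=
  measurable_borelConstantTerm νN 𝓕 (measurable_coe_comp_toBorelQuotient k c₁ μZ f)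

/-- `Ψ₀` is left-`N(𝔸)B(F)`-invariant (★ FILE A `borelConstantTerm_adelicUnipBorel_mul`). [cite: MoeglinWaldspurger1995, I.2.6] -/
theorem fibreAverage_adelicUnipBorel_mul [νN.IsHaarMeasure] [νN.IsMulRightInvariant] (h𝓕 : IsFundamentalDomain ↥(rationalUnipotent F E c N) 𝓕 νN) :
    ∀ x ∈ adelicUnipBorelSubgroup F E c N, ∀ g : (quasiSplit F E c N).Adelic,
      borelConstantTerm νN 𝓕 ((f : borelQuotient F E c N → ℂ) ∘ toBorelQuotient F E c N) (x * g) =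
        borelConstantTerm νN 𝓕 ((f : borelQuotient F E c N → ℂ) ∘ toBorelQuotient F E c N) g :=
  borelConstantTerm_adelicUnipBorel_mul νN h𝓕 (coe_comp_toBorelQuotient_mul (f : borelQuotient F E c N → ℂ))

/-- `zFun Ψ₀ ∘ π = Ψ₀` (`Ψ₀` is left-`B(F)`-invariant). [cite: BernsteinLapid2019, §4 p. 10] -/
theorem zFun_fibreAverage_toBorelQuotient [νN.IsHaarMeasure] [νN.IsMulRightInvariant] (h𝓕 : IsFundamentalDomain ↥(rationalUnipotent F E c N) 𝓕 νN)
    (g : (quasiSplit F E c N).Adelic) :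
    zFun F E c N (borelConstantTerm νN 𝓕 ((f : borelQuotient F E c N → ℂ) ∘ toBorelQuotient F E c N)) (toBorelQuotient F E c N g) =
      borelConstantTerm νN 𝓕 ((f : borelQuotient F E c N → ℂ) ∘ toBorelQuotient F E c N) g :=
  zFun_toBorelQuotient F E c N (fun γ hγ => fibreAverage_adelicUnipBorel_mul k c₁ μZ f νN 𝓕 h𝓕 γ (ratBorelSubgroup_le_adelicUnipBorelSubgroup F E c N hγ)) g

end Lift

/-! ## §2 The `L²` bound, the class `[Ψ₀] ∈ range cnst_k`, orthogonality, and the vanishing of `∫ β·𝟙·H^{−2k}·‖Ψ₀‖²` -/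

section Core

variable (νG : Measure (quasiSplit F E c N).Adelic) [νG.IsHaarMeasure]
  (νN : Measure ↥(adelicUnipotent F E c N)) [νN.IsHaarMeasure] [νN.IsInvInvariant] [νN.IsMulRightInvariant]
  (hconj : ∀ b₀ (hb₀ : b₀ ∈ borelU (c : E →+* E) ((StdForm.antidiagonal N).over E)),
    νN.map (fun v : ↥(adelicUnipotent F E c N) => (⟨((quasiSplit F E c N).toAdelic b₀)⁻¹ * (v : (quasiSplit F E c N).Adelic) * (quasiSplit F E c N).toAdelic b₀,
      conj_mem_adelicUnipotent ((K2E1PseudoEisensteinConstantTermU.toAdelic_mem_borelAdelic_iff b₀).2 hb₀) v.2⟩ : ↥(adelicUnipotent F E c N))) = νN)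
  {𝓕 : Set ↥(adelicUnipotent F E c N)} (h𝓕 : IsFundamentalDomain ↥(rationalUnipotent F E c N) 𝓕 νN) (h𝓕₀ : νN 𝓕 ≠ 0) (h𝓕top : νN 𝓕 ≠ ∞)
  {β : (quasiSplit F E c N).Adelic → ℝ≥0∞} (hβ : IsCoveringWeight ↥((arithmeticBorel F E c N).map (quasiSplit F E c N).arithmeticSubgroup.subtype) β)
  {μZ : Measure (borelQuotient F E c N)}
  (hμZ : ∀ f : borelQuotient F E c N → ℝ≥0∞, Measurable f → ∫⁻ z, f z ∂μZ = ∫⁻ g, β g * f (toBorelQuotient F E c N g) ∂νG)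
  (k : ℕ) (c₁ : ℝ≥0)

/-- The truncation weight `w = 𝟙_{c<H}·H^{−2k}` on `G(𝔸)` (as `ℝ≥0`) is Borel. [cite: BernsteinLapid2019, §4 p. 10] -/
theorem measurable_truncWeightNNReal :
    Measurable fun y : (quasiSplit F E c N).Adelic => ({y : (quasiSplit F E c N).Adelic | c₁ < borelHeight y}.indicator (fun y => ((borelHeight y)⁻¹ ^ (2 * k) : ℝ≥0)) y : ℝ≥0) := by
  have hH : Measurable (borelHeight : (quasiSplit F E c N).Adelic → ℝ≥0) := continuous_borelHeight.measurable
  exact (hH.inv.pow_const _).indicator (measurableSet_lt measurable_const hH)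

omit [BorelSpace (quasiSplit F E c N).Adelic] [νG.IsHaarMeasure] in
include hμZ in
/-- The unfolded square norm of the lift is `∫⁻_Z ‖f‖² dμw < ∞` (★ `lintegral_weightedTruncMeasure_eq_of_unfolding`). [cite: BernsteinLapid2019, §4 p. 10] -/
theorem lintegral_unfold_sq_lift_lt_top (f : HN F E c N k c₁ μZ) :
    ∫⁻ g, β g * ((({y : (quasiSplit F E c N).Adelic | c₁ < borelHeight y}.indicator (fun y => ((borelHeight y)⁻¹ ^ (2 * k) : ℝ≥0)) g : ℝ≥0) : ℝ≥0∞) *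
      ‖((f : borelQuotient F E c N → ℂ) ∘ toBorelQuotient F E c N) g‖ₑ ^ 2) ∂νG < ∞ := by
  have hT := lintegral_weightedTruncMeasure_eq_of_unfolding νG hμZ k c₁ (f := fun z => ‖(f : borelQuotient F E c N → ℂ) z‖ₑ ^ 2)
    ((Lp.stronglyMeasurable f).measurable.enorm.pow_const 2)
  have heq : ∫⁻ g, β g * ((({y : (quasiSplit F E c N).Adelic | c₁ < borelHeight y}.indicator (fun y => ((borelHeight y)⁻¹ ^ (2 * k) : ℝ≥0)) g : ℝ≥0) : ℝ≥0∞) *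
      ‖((f : borelQuotient F E c N → ℂ) ∘ toBorelQuotient F E c N) g‖ₑ ^ 2) ∂νG =
      ∫⁻ g, β g * {y : (quasiSplit F E c N).Adelic | c₁ < borelHeight y}.indicator
        (fun y => (((borelHeight y)⁻¹ ^ (2 * k) : ℝ≥0) : ℝ≥0∞) * ‖(f : borelQuotient F E c N → ℂ) (toBorelQuotient F E c N y)‖ₑ ^ 2) g ∂νG := by
    refine lintegral_congr fun g => ?_
    by_cases hg : c₁ < borelHeight g
    · simp only [Set.indicator_of_mem (show g ∈ {y : (quasiSplit F E c N).Adelic | c₁ < borelHeight y} from hg), Function.comp_apply]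
    · simp only [Set.indicator_of_notMem (show g ∉ {y : (quasiSplit F E c N).Adelic | c₁ < borelHeight y} from hg), ENNReal.coe_zero, zero_mul, mul_zero]
  rw [heq, ← hT]
  have h2 := lintegral_rpow_enorm_lt_top_of_eLpNorm_lt_top two_ne_zero ENNReal.ofNat_ne_top (Lp.memLp f).eLpNorm_lt_top
  simp only [ENNReal.toReal_ofNat, ENNReal.rpow_two] at h2
  exact h2

omit [νN.IsMulRightInvariant] in
include hconj h𝓕 h𝓕₀ h𝓕top hβ hμZ in
/-- **THE UNFOLDED `L²`-NORM OF THE FIBRE AVERAGE IS FINITE**: `∫⁻ β·𝟙_{c<H}·H^{−2k}·‖Ψ₀‖² dν_G ≤ ∫⁻_Z ‖f‖² dμw < ∞` (★ FILE J fibre Jensen with the invariant weight `𝟙_{c<H}H^{−2k}`).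
[cite: MoeglinWaldspurger1995, I.2.6, II.1.7] -/
theorem lintegral_unfold_sq_fibreAverage_lt_top (f : HN F E c N k c₁ μZ) :
    ∫⁻ g, β g * ((({y : (quasiSplit F E c N).Adelic | c₁ < borelHeight y}.indicator (fun y => ((borelHeight y)⁻¹ ^ (2 * k) : ℝ≥0)) g : ℝ≥0) : ℝ≥0∞) *
      ‖borelConstantTerm νN 𝓕 ((f : borelQuotient F E c N → ℂ) ∘ toBorelQuotient F E c N) g‖ₑ ^ 2) ∂νG < ∞ :=
  lt_of_le_of_lt (lintegral_mul_enorm_borelConstantTerm_sq_le_of νG νN hconj h𝓕 h𝓕₀ h𝓕top hβ (measurable_coe_comp_toBorelQuotient k c₁ μZ f)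
    (coe_comp_toBorelQuotient_arithmeticBorel_mul k c₁ μZ f) (measurable_truncWeightNNReal k c₁)
    (fun u g => by simp only [Set.indicator, Set.mem_setOf_eq, borelHeight_unipotent_mul u.2 g])
    (fun b hb x => by simp only [Set.indicator, Set.mem_setOf_eq, K2E1TruncatedEisensteinExplicit.borelHeight_arithmeticBorel_mul hb x]))
    (lintegral_unfold_sq_lift_lt_top νG hμZ k c₁ f)

include hconj h𝓕 h𝓕₀ h𝓕top hβ hμZ in
/-- **`zFun Ψ₀ ∈ L²(μw)`**: measurable (★ FILE M, Borel descent along the discrete `B(F)`) with finite unfolded square norm (previous lemma, transported back to `Z` by ★ `hμZ`).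
[cite: MoeglinWaldspurger1995, I.2.6] [cite: BernsteinLapid2019, §4 Claim 4 p. 10] -/
theorem memLp_zFun_fibreAverage (f : HN F E c N k c₁ μZ) :
    MemLp (zFun F E c N (borelConstantTerm νN 𝓕 ((f : borelQuotient F E c N → ℂ) ∘ toBorelQuotient F E c N))) 2 (weightedTruncMeasure F E c N k c₁ μZ) := by
  haveI := sFinite_of_isHaarMeasure_adelicUnipotent νN
  have hΨm := measurable_fibreAverage k c₁ μZ f νN 𝓕
  have hΨB : ∀ γ ∈ ratBorelSubgroup F E c N, ∀ g : (quasiSplit F E c N).Adelic,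
      borelConstantTerm νN 𝓕 ((f : borelQuotient F E c N → ℂ) ∘ toBorelQuotient F E c N) (γ * g) =
        borelConstantTerm νN 𝓕 ((f : borelQuotient F E c N → ℂ) ∘ toBorelQuotient F E c N) g :=
    fun γ hγ => fibreAverage_adelicUnipBorel_mul k c₁ μZ f νN 𝓕 h𝓕 γ (ratBorelSubgroup_le_adelicUnipBorelSubgroup F E c N hγ)
  have hzm : Measurable (zFun F E c N (borelConstantTerm νN 𝓕 ((f : borelQuotient F E c N → ℂ) ∘ toBorelQuotient F E c N))) :=
    measurable_zFun_of_measurable hΨm hΨB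
  refine ⟨hzm.aestronglyMeasurable, (eLpNorm_lt_top_iff_lintegral_rpow_enorm_lt_top two_ne_zero ENNReal.ofNat_ne_top).2 ?_⟩
  simp only [ENNReal.toReal_ofNat, ENNReal.rpow_two]
  rw [lintegral_weightedTruncMeasure_eq_of_unfolding νG hμZ k c₁ (hzm.enorm.pow_const 2)]
  have heq : ∫⁻ g, β g * {y : (quasiSplit F E c N).Adelic | c₁ < borelHeight y}.indicator
        (fun y => (((borelHeight y)⁻¹ ^ (2 * k) : ℝ≥0) : ℝ≥0∞) *
          ‖zFun F E c N (borelConstantTerm νN 𝓕 ((f : borelQuotient F E c N → ℂ) ∘ toBorelQuotient F E c N)) (toBorelQuotient F E c N y)‖ₑ ^ 2) g ∂νG =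
      ∫⁻ g, β g * ((({y : (quasiSplit F E c N).Adelic | c₁ < borelHeight y}.indicator (fun y => ((borelHeight y)⁻¹ ^ (2 * k) : ℝ≥0)) g : ℝ≥0) : ℝ≥0∞) *
        ‖borelConstantTerm νN 𝓕 ((f : borelQuotient F E c N → ℂ) ∘ toBorelQuotient F E c N) g‖ₑ ^ 2) ∂νG := by
    refine lintegral_congr fun g => ?_
    by_cases hg : c₁ < borelHeight g
    · simp only [Set.indicator_of_mem (show g ∈ {y : (quasiSplit F E c N).Adelic | c₁ < borelHeight y} from hg),
        zFun_fibreAverage_toBorelQuotient k c₁ μZ f νN 𝓕 h𝓕 g]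
    · simp only [Set.indicator_of_notMem (show g ∉ {y : (quasiSplit F E c N).Adelic | c₁ < borelHeight y} from hg), ENNReal.coe_zero, zero_mul, mul_zero]
  rw [heq]
  exact lintegral_unfold_sq_fibreAverage_lt_top νG νN hconj h𝓕 h𝓕₀ h𝓕top hβ hμZ k c₁ f

omit [MeasurableSpace (quasiSplit F E c N).Adelic] [BorelSpace (quasiSplit F E c N).Adelic] in
/-- **`f ∈ 𝓗^cusp` IS ORTHOGONAL TO THE `mN`-MEASURABLE CLASSES**: `cnst_k` is the self-adjoint projection onto `lpMeas` (★ `inner_cnstN_left_eq_right`, ★ `cnstN_eq_self_of_mem_lpMeas`), so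
`cnst_k f = 0` gives `⟪f, h⟫ = 0` for every `h ∈ lpMeas`. [cite: BernsteinLapid2019, §4 Claim 4 p. 10] -/
theorem inner_eq_zero_of_mem_HNcusp_of_mem_lpMeas {f h : HN F E c N k c₁ μZ} (hf : f ∈ HNcusp F E c N k c₁ μZ)
    (hh : h ∈ lpMeas ℂ ℂ (invariantSigma F E c N) 2 (weightedTruncMeasure F E c N k c₁ μZ)) : ⟪f, h⟫_ℂ = 0 := by
  rw [← cnstN_eq_self_of_mem_lpMeas hh, ← inner_cnstN_left_eq_right, (mem_HNcusp_iff F E c N k c₁ μZ f).1 hf, inner_zero_left]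

include hconj h𝓕 h𝓕₀ h𝓕top hβ hμZ in
/-- **STEP 3: `∫ β·𝟙_{c<H}·H^{−2k}·‖Ψ₀‖² dν_G = 0` for `f ∈ 𝓗^cusp`.**  The class `[zFun Ψ₀]` is in `lpMeas` (★ FILE M + the `L²` bound), so `⟪f, [zFun Ψ₀]⟫ = 0` (§2); unfolded by ★
`integral_weightedTruncMeasure_eq_of_unfolding` this is `∫ β·(w·Ψ₀ · conj Φ₀) dν_G = 0` with `w = 𝟙_{c<H}H^{−2k}`, and ★ AVG-4 (the factor `w·Ψ₀` is left-`N(𝔸)`-invariant) replaces `conj Φ₀`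
by `conj (Φ₀)_B = conj Ψ₀`. [cite: MoeglinWaldspurger1995, I.2.18, II.1.7] [cite: BernsteinLapid2019, §4 Claim 5 p. 10] -/
theorem integral_wt_sq_fibreAverage_eq_zero (f : HN F E c N k c₁ μZ) (hf : f ∈ HNcusp F E c N k c₁ μZ) :
    ∫ g, (β g).toReal * ((({y : (quasiSplit F E c N).Adelic | c₁ < borelHeight y}.indicator (fun y => ((borelHeight y)⁻¹ ^ (2 * k) : ℝ≥0)) g : ℝ≥0) : ℝ) *
      ‖borelConstantTerm νN 𝓕 ((f : borelQuotient F E c N → ℂ) ∘ toBorelQuotient F E c N) g‖ ^ 2) ∂νG = 0 := by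
  set Φ₀ : (quasiSplit F E c N).Adelic → ℂ := (f : borelQuotient F E c N → ℂ) ∘ toBorelQuotient F E c N with hΦ₀
  set Ψ₀ : (quasiSplit F E c N).Adelic → ℂ := borelConstantTerm νN 𝓕 Φ₀ with hΨ₀
  set w : (quasiSplit F E c N).Adelic → ℝ≥0 := fun y => {y : (quasiSplit F E c N).Adelic | c₁ < borelHeight y}.indicator (fun y => ((borelHeight y)⁻¹ ^ (2 * k) : ℝ≥0)) y with hw
  haveI := sFinite_of_isHaarMeasure_adelicUnipotent νN
  have hΦm : Measurable Φ₀ := measurable_coe_comp_toBorelQuotient k c₁ μZ f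
  have hΨm : Measurable Ψ₀ := measurable_fibreAverage k c₁ μZ f νN 𝓕
  have hwm : Measurable w := measurable_truncWeightNNReal k c₁
  have hΨinv : ∀ x ∈ adelicUnipBorelSubgroup F E c N, ∀ g : (quasiSplit F E c N).Adelic, Ψ₀ (x * g) = Ψ₀ g :=
    fibreAverage_adelicUnipBorel_mul k c₁ μZ f νN 𝓕 h𝓕
  have hzΨ : ∀ g : (quasiSplit F E c N).Adelic, zFun F E c N Ψ₀ (toBorelQuotient F E c N g) = Ψ₀ g :=
    zFun_fibreAverage_toBorelQuotient k c₁ μZ f νN 𝓕 h𝓕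
  have hwN : ∀ (u : ↥(adelicUnipotent F E c N)) (g : (quasiSplit F E c N).Adelic), w ((u : (quasiSplit F E c N).Adelic) * g) = w g := fun u g => by
    simp only [hw, Set.indicator, Set.mem_setOf_eq, borelHeight_unipotent_mul u.2 g]
  have hwB : ∀ b ∈ arithmeticBorel F E c N, ∀ x : (quasiSplit F E c N).Adelic, w ((b : (quasiSplit F E c N).Adelic) * x) = w x := fun b hb x => by
    simp only [hw, Set.indicator, Set.mem_setOf_eq, K2E1TruncatedEisensteinExplicit.borelHeight_arithmeticBorel_mul hb x]
  -- STEP 1: the class `hΨ = [zFun Ψ₀] ∈ lpMeas`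
  have hmem := memLp_zFun_fibreAverage νG νN hconj h𝓕 h𝓕₀ h𝓕top hβ hμZ k c₁ f
  have hmN : Measurable[invariantSigma F E c N] (zFun F E c N Ψ₀) := measurable_invariantSigma_zFun_of_measurable hΨm hΨinv
  have hlp : hmem.toLp (zFun F E c N Ψ₀) ∈ lpMeas ℂ ℂ (invariantSigma F E c N) 2 (weightedTruncMeasure F E c N k c₁ μZ) :=
    mem_lpMeas_iff_aestronglyMeasurable.2 ⟨zFun F E c N Ψ₀, hmN.stronglyMeasurable, hmem.coeFn_toLp⟩
  -- STEP 2: `⟪f, hΨ⟫ = 0`, as an integral on `Z`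
  have hinner := inner_eq_zero_of_mem_HNcusp_of_mem_lpMeas k c₁ hf hlp
  have hZ : ∫ z, conj ((f : borelQuotient F E c N → ℂ) z) * zFun F E c N Ψ₀ z ∂weightedTruncMeasure F E c N k c₁ μZ = 0 := by
    rw [L2.inner_def] at hinner; rw [← hinner]
    refine integral_congr_ae ?_
    filter_upwards [hmem.coeFn_toLp] with z hz
    rw [hz, RCLike.inner_apply, mul_comm]
  have hae : AEStronglyMeasurable (fun z => conj ((f : borelQuotient F E c N → ℂ) z) * zFun F E c N Ψ₀ z) (weightedTruncMeasure F E c N k c₁ μZ) :=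
    (Complex.continuous_conj.comp_aestronglyMeasurable (Lp.aestronglyMeasurable f)).mul hmem.1
  have hG := integral_weightedTruncMeasure_eq_of_unfolding νG hβ hμZ k c₁ hae
  rw [hZ] at hG
  -- rewrite the unfolded integrand as `(β g).toReal • (ψ g * conj (Φ₀ g))`, `ψ = w·Ψ₀`
  have hψm : Measurable fun g => (((w g : ℝ)) : ℂ) * Ψ₀ g := (Complex.measurable_ofReal.comp (measurable_subtype_coe.comp hwm)).mul hΨm
  have hint : (fun g => (β g).toReal • {y : (quasiSplit F E c N).Adelic | c₁ < borelHeight y}.indicator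
        (fun y => (((borelHeight y)⁻¹ ^ (2 * k) : ℝ≥0) : ℝ) • (conj ((f : borelQuotient F E c N → ℂ) (toBorelQuotient F E c N y)) * zFun F E c N Ψ₀ (toBorelQuotient F E c N y))) g) =
      fun g => (β g).toReal • ((((w g : ℝ)) : ℂ) * Ψ₀ g * conj (Φ₀ g)) := by
    funext g
    congr 1
    by_cases hg : c₁ < borelHeight g
    · have hwg : w g = (borelHeight g)⁻¹ ^ (2 * k) := by
        simp only [hw, Set.indicator_of_mem (show g ∈ {y : (quasiSplit F E c N).Adelic | c₁ < borelHeight y} from hg)]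
      simp only [Set.indicator_of_mem (show g ∈ {y : (quasiSplit F E c N).Adelic | c₁ < borelHeight y} from hg), hzΨ g, hwg, Complex.real_smul]
      simp only [hΦ₀, Function.comp_apply]
      ring
    · have hwg : w g = 0 := by
        simp only [hw, Set.indicator_of_notMem (show g ∉ {y : (quasiSplit F E c N).Adelic | c₁ < borelHeight y} from hg)]
      simp only [Set.indicator_of_notMem (show g ∉ {y : (quasiSplit F E c N).Adelic | c₁ < borelHeight y} from hg), hwg]
      simp
  rw [hint] at hG
  -- STEP 3: ★ AVG-4 with `ψ = w·Ψ₀` (left-`N(𝔸)`- and `B(F)♯`-invariant) and `Λ' = Φ₀`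
  have hL1 : ∫⁻ g, β g * ‖(((w g : ℝ)) : ℂ) * Ψ₀ g * conj (Φ₀ g)‖ₑ ∂νG < ∞ := by
    have hw' : ∀ g, ‖(((w g : ℝ)) : ℂ)‖ₑ = (w g : ℝ≥0∞) := fun g => by rw [enorm_eq_nnnorm, Complex.nnnorm_real, NNReal.nnnorm_eq]
    have hab : ∀ a b : ℝ≥0∞, a * b ≤ a ^ 2 + b ^ 2 := fun a b => by  -- (also ★ `Literature.Analysis.FluidPDE.ennreal_mul_le_sq_add_sq`; not worth the import)
      rcases le_total a b with h | h
      · exact (mul_le_mul' h le_rfl).trans (le_of_eq_of_le (sq b).symm le_add_self)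
      · exact (mul_le_mul' le_rfl h).trans (le_of_eq_of_le (sq a).symm le_self_add)
    have hle : ∀ g, β g * ‖(((w g : ℝ)) : ℂ) * Ψ₀ g * conj (Φ₀ g)‖ₑ ≤ β g * ((w g : ℝ≥0∞) * ‖Ψ₀ g‖ₑ ^ 2) + β g * ((w g : ℝ≥0∞) * ‖Φ₀ g‖ₑ ^ 2) := fun g => by
      rw [enorm_mul, enorm_mul, hw', RCLike.enorm_conj, ← mul_add, ← mul_add, mul_assoc]
      exact mul_le_mul' le_rfl (mul_le_mul' le_rfl (hab _ _))
    refine lt_of_le_of_lt (lintegral_mono hle) ?_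
    rw [lintegral_add_left (show Measurable (fun g => β g * ((w g : ℝ≥0∞) * ‖Ψ₀ g‖ₑ ^ 2)) from
      hβ.measurable.mul ((measurable_coe_nnreal_ennreal.comp hwm).mul (hΨm.enorm.pow_const 2)))]
    exact ENNReal.add_lt_top.2 ⟨lintegral_unfold_sq_fibreAverage_lt_top νG νN hconj h𝓕 h𝓕₀ h𝓕top hβ hμZ k c₁ f, lintegral_unfold_sq_lift_lt_top νG hμZ k c₁ f⟩
  have hAVG := integral_wt_smul_mul_conj_eq_mul_conj_borelConstantTerm_of νG νN hconj h𝓕 h𝓕₀ h𝓕top hβ hψm hΦm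
    (fun u g => by show (((w ((u : (quasiSplit F E c N).Adelic) * g) : ℝ)) : ℂ) * Ψ₀ ((u : (quasiSplit F E c N).Adelic) * g) = (((w g : ℝ)) : ℂ) * Ψ₀ g
                   rw [hwN u g, hΨinv _ (Subgroup.mem_sup_left u.2) g])
    (fun b hb x => by show (((w ((b : (quasiSplit F E c N).Adelic) * x) : ℝ)) : ℂ) * Ψ₀ ((b : (quasiSplit F E c N).Adelic) * x) = (((w x : ℝ)) : ℂ) * Ψ₀ x
                      rw [hwB b hb x, hΨinv _ (ratBorelSubgroup_le_adelicUnipBorelSubgroup F E c N ⟨(mem_arithmeticBorel_iff b).1 hb, b.2⟩) x])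
    (coe_comp_toBorelQuotient_arithmeticBorel_mul k c₁ μZ f) hL1
  rw [← hG] at hAVG
  -- the right-hand side is the real integral of `β·w·‖Ψ₀‖²`, cast to `ℂ`
  have hrhs : ∫ g, (β g).toReal • ((((w g : ℝ)) : ℂ) * Ψ₀ g * conj (borelConstantTerm νN 𝓕 Φ₀ g)) ∂νG =
      ((∫ g, (β g).toReal * ((w g : ℝ) * ‖Ψ₀ g‖ ^ 2) ∂νG : ℝ) : ℂ) := by
    rw [← integral_complex_ofReal]
    refine integral_congr_ae (ae_of_all _ fun g => ?_)
    show (β g).toReal • ((((w g : ℝ)) : ℂ) * Ψ₀ g * conj (Ψ₀ g)) = _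
    rw [mul_assoc, Complex.mul_conj', Complex.real_smul]
    push_cast; ring
  rw [hrhs] at hAVG
  exact_mod_cast hAVG.symm

/-! ## §3 The heads: `Ψ₀ = 0` a.e. above the height `c`, and the agreed truncated-lift form -/

include hconj h𝓕 h𝓕₀ h𝓕top hβ hμZ in
/-- **HEAD, FIBRE-AVERAGE FORM: the fibre average of the lift of a cuspidal class vanishes `ν_G`-a.e. above the height `c`** — `∀ᵐ g ∂ν_G, c < H(g) → (⇑f ∘ π)_B(g) = 0` for every
`f ∈ 𝓗_k^cusp(Z_c)`.  STEP 3 (§2) makes `β·𝟙_{c<H}H^{−2k}·‖Ψ₀‖²` a non-negative integrable function with integral `0`, so `Ψ₀ = 0` a.e. on `{β ≠ 0} ∩ {c < H}`; the bad set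
`{c < H, Ψ₀ ≠ 0}` is `B(F)♯`-invariant, `ν_G` is `B(F)♯`-invariant, `B(F)♯` is countable and `Σ_γ β(γ g) = 1` (★ `IsCoveringWeight`), so it is covered by countably many null sets.
[cite: MoeglinWaldspurger1995, I.2.18] [cite: BernsteinLapid2019, §4 Claim 5 p. 10] -/
theorem ae_fibreAverage_eq_zero_of_mem_HNcusp (f : HN F E c N k c₁ μZ) (hf : f ∈ HNcusp F E c N k c₁ μZ) :
    ∀ᵐ g ∂νG, c₁ < borelHeight g → borelConstantTerm νN 𝓕 ((f : borelQuotient F E c N → ℂ) ∘ toBorelQuotient F E c N) g = 0 := by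
  classical
  haveI : Countable ↥((arithmeticBorel F E c N).map (quasiSplit F E c N).arithmeticSubgroup.subtype) := by
    obtain ⟨e, -⟩ := exists_equiv_torus_prod_rationalUnipotent (F := F) (E := E) (c := c) (N := N)
    haveI := countable_mapTorus (F := F) (E := E) (c := c) (N := N)
    haveI := countable_rationalUnipotent' (F := F) (E := E) (c := c) (N := N)
    exact Countable.of_equiv _ e
  haveI := K2E1IntertwiningAdjointEngine.measurableConstSMul_subgroup ((arithmeticBorel F E c N).map (quasiSplit F E c N).arithmeticSubgroup.subtype)
  haveI := K2E1IntertwiningAdjointEngine.smulInvariantMeasure_subgroup ((arithmeticBorel F E c N).map (quasiSplit F E c N).arithmeticSubgroup.subtype) νG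
  haveI := sFinite_of_isHaarMeasure_adelicUnipotent νN
  set Ψ₀ : (quasiSplit F E c N).Adelic → ℂ := borelConstantTerm νN 𝓕 ((f : borelQuotient F E c N → ℂ) ∘ toBorelQuotient F E c N) with hΨ₀
  have hΨm : Measurable Ψ₀ := measurable_fibreAverage k c₁ μZ f νN 𝓕
  have hΨinv : ∀ x ∈ adelicUnipBorelSubgroup F E c N, ∀ g : (quasiSplit F E c N).Adelic, Ψ₀ (x * g) = Ψ₀ g :=
    fibreAverage_adelicUnipBorel_mul k c₁ μZ f νN 𝓕 h𝓕
  have hβm := hβ.measurable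
  have hβfin : ∀ g, β g ≠ ∞ := fun g => ne_top_of_le_ne_top ENNReal.one_ne_top (hβ.le_one g)
  -- the integrand `R = β·w·‖Ψ₀‖²` (real, ≥ 0, integrable) has integral `0`
  set R : (quasiSplit F E c N).Adelic → ℝ := fun g => (β g).toReal *
    ((({y : (quasiSplit F E c N).Adelic | c₁ < borelHeight y}.indicator (fun y => ((borelHeight y)⁻¹ ^ (2 * k) : ℝ≥0)) g : ℝ≥0) : ℝ) * ‖Ψ₀ g‖ ^ 2) with hR
  have hR0 : ∫ g, R g ∂νG = 0 := integral_wt_sq_fibreAverage_eq_zero νG νN hconj h𝓕 h𝓕₀ h𝓕top hβ hμZ k c₁ f hf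
  have hwm := measurable_truncWeightNNReal (F := F) (E := E) (c := c) (N := N) k c₁
  have hRm : Measurable R := hβm.ennreal_toReal.mul ((measurable_coe_nnreal_real.comp hwm).mul (hΨm.norm.pow_const 2))
  have hRnn : ∀ g, 0 ≤ R g := fun g => mul_nonneg ENNReal.toReal_nonneg (mul_nonneg (NNReal.coe_nonneg _) (sq_nonneg _))
  have hRint : Integrable R νG := by
    refine ⟨hRm.aestronglyMeasurable, ?_⟩
    have hfin := lintegral_unfold_sq_fibreAverage_lt_top νG νN hconj h𝓕 h𝓕₀ h𝓕top hβ hμZ k c₁ f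
    refine lt_of_le_of_lt (lintegral_mono fun g => le_of_eq ?_) hfin
    rw [Real.enorm_eq_ofReal (hRnn g)]; simp only [hR]
    rw [ENNReal.ofReal_mul ENNReal.toReal_nonneg, ENNReal.ofReal_toReal (hβfin g), ENNReal.ofReal_mul (NNReal.coe_nonneg _), ENNReal.ofReal_coe_nnreal,
      ← ofReal_norm, ← ENNReal.ofReal_pow (norm_nonneg _)]
  have hRae : R =ᵐ[νG] 0 := (integral_eq_zero_iff_of_nonneg (fun g => hRnn g) hRint).1 hR0
  -- hence `Ψ₀ = 0` a.e. on `{β ≠ 0} ∩ {c₁ < H}`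
  have hae1 : ∀ᵐ g ∂νG, β g ≠ 0 → c₁ < borelHeight g → Ψ₀ g = 0 := by
    filter_upwards [hRae] with g hg hβg hHg
    have hw : (({y : (quasiSplit F E c N).Adelic | c₁ < borelHeight y}.indicator (fun y => ((borelHeight y)⁻¹ ^ (2 * k) : ℝ≥0)) g : ℝ≥0) : ℝ) ≠ 0 := by
      rw [Set.indicator_of_mem (show g ∈ {y : (quasiSplit F E c N).Adelic | c₁ < borelHeight y} from hHg)]
      exact ne_of_gt (by exact_mod_cast pow_pos (inv_pos.2 (borelHeight_pos g)) _)
    have hβ' : (β g).toReal ≠ 0 := ENNReal.toReal_ne_zero.2 ⟨hβg, hβfin g⟩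
    simpa only [hR, Pi.zero_apply, mul_eq_zero, hβ', hw, false_or, pow_eq_zero_iff two_ne_zero, norm_eq_zero] using hg
  -- the bad set and its `B(F)♯`-translates
  set S : Set (quasiSplit F E c N).Adelic := {g | c₁ < borelHeight g ∧ Ψ₀ g ≠ 0} with hS
  have hS0 : νG (S ∩ {g | β g ≠ 0}) = 0 := by
    refine measure_eq_zero_iff_ae_notMem.2 ?_
    filter_upwards [hae1] with g hg hmem
    exact hmem.1.2 (hg hmem.2 hmem.1.1)
  -- `S` is `B(F)♯`-invariant, so every translate `S ∩ {β(γ·) ≠ 0}` is null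
  have hSinv : ∀ (γ : ↥((arithmeticBorel F E c N).map (quasiSplit F E c N).arithmeticSubgroup.subtype)) (g : (quasiSplit F E c N).Adelic), γ • g ∈ S ↔ g ∈ S := by
    rintro ⟨_, ⟨b, hb, rfl⟩⟩ g
    change ((b : (quasiSplit F E c N).arithmeticSubgroup) : (quasiSplit F E c N).Adelic) * g ∈ S ↔ g ∈ S
    simp only [hS, Set.mem_setOf_eq, K2E1TruncatedEisensteinExplicit.borelHeight_arithmeticBorel_mul hb g,
      hΨinv _ (ratBorelSubgroup_le_adelicUnipBorelSubgroup F E c N ⟨(mem_arithmeticBorel_iff b).1 hb, b.2⟩) g]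
  have hT0 : ∀ γ : ↥((arithmeticBorel F E c N).map (quasiSplit F E c N).arithmeticSubgroup.subtype), νG (S ∩ {g | β (γ • g) ≠ 0}) = 0 := by
    intro γ
    have heq : S ∩ {g | β (γ • g) ≠ 0} = (fun g => γ • g) ⁻¹' (S ∩ {g | β g ≠ 0}) := by
      ext g
      simp only [Set.mem_inter_iff, Set.mem_preimage, Set.mem_setOf_eq, hSinv γ g]
    rw [heq]
    exact measure_preimage_smul_null hS0 γ
  -- the covering: `Σ_γ β(γ g) = 1` forces some `β(γ g) ≠ 0`
  have hcov : S ⊆ ⋃ γ : ↥((arithmeticBorel F E c N).map (quasiSplit F E c N).arithmeticSubgroup.subtype), S ∩ {g | β (γ • g) ≠ 0} := by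
    intro g hg
    obtain ⟨γ, hγ⟩ : ∃ γ : ↥((arithmeticBorel F E c N).map (quasiSplit F E c N).arithmeticSubgroup.subtype), β (γ • g) ≠ 0 := by
      by_contra h
      push Not at h
      have h1 := hβ.coveringSum_eq g
      rw [coveringSum_apply, ENNReal.tsum_eq_zero.2 h] at h1
      exact zero_ne_one h1
    exact Set.mem_iUnion.2 ⟨γ, hg, hγ⟩
  have hSnull : νG S = 0 := measure_mono_null hcov (measure_iUnion_null hT0)
  filter_upwards [measure_eq_zero_iff_ae_notMem.1 hSnull] with g hg hHg
  by_contra hne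
  exact hg ⟨hHg, hne⟩

include hconj h𝓕 h𝓕₀ h𝓕top hβ hμZ in
/-- **HEAD, THE AGREED BYTES — `hcnst` HALF (ii), P2b-SIDE, GENERAL CLASS**: for every `f ∈ 𝓗_k^cusp(Z_c)`, the Borel constant term (w.r.t. ANY Haar measure `ν_N` on `N(𝔸)` invariant
under inversion and right translation — automatic on the abelian `N(𝔸)` of `U(1,1)` — and ANY fundamental domain `𝓕` of `N(F)` of finite non-zero measure) of the TRUNCATED lift
`𝟙_{c<HZ}·⇑f ∘ π` vanishes for `ν_G`-a.e. `g` with `c < H(g)` (there the truncation is invisible along the fibre `N(𝔸)·g`, `H(u g) = H(g)`).  Consumed by K2E1-p11's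
`hcnst_of_ae_borelConstantTerm_eq_zero` as its `hii` (threshold `cP := c`; any `cP ≥ c` a fortiori). [cite: BernsteinLapid2019, §4 Claim 5 (p. 10)] [cite: MoeglinWaldspurger1995, I.2.18] -/
theorem ae_borelConstantTerm_indicator_comp_eq_zero_of_mem_HNcusp (f : ↥(HNcusp F E c N k c₁ μZ)) :
    ∀ᵐ g ∂νG, c₁ < borelHeight g →
      borelConstantTerm νN 𝓕 (({z : borelQuotient F E c N | c₁ < borelQuotHeight F E c N z}.indicator ((f : HN F E c N k c₁ μZ) : borelQuotient F E c N → ℂ)) ∘ toBorelQuotient F E c N) g = 0 := by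
  filter_upwards [ae_fibreAverage_eq_zero_of_mem_HNcusp νG νN hconj h𝓕 h𝓕₀ h𝓕top hβ hμZ k c₁ (f : HN F E c N k c₁ μZ) f.2] with g hg hHg
  rw [← hg hHg, borelConstantTerm_def, borelConstantTerm_def]
  congr 1
  refine integral_congr_ae (ae_of_all _ fun u => ?_)
  have hmem : toBorelQuotient F E c N ((u : (quasiSplit F E c N).Adelic) * g) ∈ {z : borelQuotient F E c N | c₁ < borelQuotHeight F E c N z} := by
    rw [Set.mem_setOf_eq, borelQuotHeight_toBorelQuotient, borelHeight_unipotent_mul u.2]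
    exact hHg
  simp only [Function.comp_apply, Set.indicator_of_mem hmem]

end Core

end Summit.HodgeConjecture.HodgeConjecture.Cruxes.H413.K2E1TruncatedCuspConstantTermAEU2

end
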